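import Mathlib.FieldTheory.KrullTopology
import Literature.NumberTheory.GaloisRepresentations.KroneckerWeber
import Literature.NumberTheory.GaloisRepresentations.CyclotomicCharacterSurjectiveProofs
import Literature.NumberTheory.EllipticCurves.ZpExtensionPadicUnitsProofs
import Literature.NumberTheory.EllipticCurves.ZpExtensionProofs
import Literature.NumberTheory.EllipticCurves.ZpExtensionDihedralProofs
import Literature.NumberTheory.EllipticCurves.ZpExtensionRank
import HarnessLib

/-!
# `ℚ` has `ℤ_p`-rank one, from the Kronecker–Weber theorem; `exists_isAnticyclotomic` from
Kronecker–Weber and the `ℤ_p`-rank of `K` (proofs only)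

The only unproved inputs of `Literature.NumberTheory.EllipticCurves.ZpExtension.exists_isAnticyclotomic` (an imaginary quadratic
field has an anticyclotomic `ℤ_p`-extension) after `ZpExtensionAnticyclotomicProofs.lean` are the
class-field-theoretic `ℤ_p`-rank facts `zpRank_eq_nrComplexPlaces_add_one` for `ℚ` (rank `1`)
and for `K` (rank `2`).  Here the `ℚ`-side is *proved* from the Kronecker–Weber theorem
(`Literature.NumberTheory.GaloisRepresentations.KroneckerWeber`, a named fact), in the form consumed by the descent
(`IndexTwo.exists_surjective_anticyclotomic`, hypothesis `hG`): any two continuous characters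
`Γ_ℚ →ₜ* ℤ_p` are `ℤ_p`-linearly dependent (`dependent_of_kroneckerWeber`), i.e. `ℚ` has at most
one `ℤ_p`-extension.  Everything is done for a field `K` of characteristic `0` with the
Kronecker–Weber property (`Literature.IsKroneckerWeber K`) over which all cyclotomic polynomials are
irreducible, and specialised to `ℚ` at the end (`Polynomial.cyclotomic.irreducible_rat`).

Architecture of the proof (Washington, §13.1: "`ℚ_∞/ℚ` is the unique `ℤ_p`-extension of `ℚ`"
via Kronecker–Weber and `Gal(ℚ(μ_∞)/ℚ) ≃ ∏_ℓ ℤ_ℓˣ`), for `F : Γ_K →ₜ* ℤ_p`: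
1. `exists_forall_smul_eq_self_imp_dvd`: `F mod pⁿ` cuts out a finite abelian extension of `K`
   (Krull correspondence for the open subgroup `F⁻¹(pⁿℤ_p)`), which lies in some `K(μ_m)` by
   Kronecker–Weber; so `σ` fixing `μ_m(K̄)` has `F σ ∈ pⁿ ℤ_p`.
2. `toAdd_apply_eq_zero_of_prime_supported`: if `σ` fixes all roots of unity of order prime to a
   prime `ℓ ≠ p` then `F σ = 0`: `σ^{φ(ℓᵏ)}` fixes `μ_m`, `m = ℓᵏ m'`, and
   `v_p(φ(ℓᵏ)) ≤ v_p(ℓ - 1)` is bounded (this is "`Hom(ℤ_ℓˣ, ℤ_p) = 0`").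
3. `toAdd_apply_eq_zero_of_forall_smul_eq_self`: if `τ` fixes `μ_{p^∞}(K̄)` then `F τ = 0`:
   peel off the finitely many primes `ℓ ∣ m`, `ℓ ≠ p`, using elements `σ_ℓ` supported at `ℓ`
   (`RootOfUnityAction.exists_smul_eq_smul_and_smul_eq_self`, which needs the irreducibility of
   the `Φₙ`) and step 2.
4. Hence `F` is trivial on `ker χ_p` and factors as `g ∘ χ_p` with `g : ℤ_pˣ →ₜ* ℤ_p`
   (`GaloisRep.exists_continuousMonoidHom_comp_cyclotomicCharacter`); two such `g` are dependent
   (`PadicUnits.dependent`, file `ZpExtensionPadicUnitsProofs.lean`).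

## Main statements

* `Literature.NumberTheory.EllipticCurves.ZpExtension.dependent_of_isKroneckerWeber`, `Literature.NumberTheory.EllipticCurves.ZpExtension.dependent_of_kroneckerWeber`:
  `ℤ_p`-rank `≤ 1` of `Hom_cont(Γ_ℚ, ℤ_p)` from Kronecker–Weber.
* `Literature.NumberTheory.EllipticCurves.ZpExtension.exists_isAnticyclotomic_of_kroneckerWeber`:
  `KroneckerWeber → zpRank_eq_nrComplexPlaces_add_one K p → exists_isAnticyclotomic`, leaving
  global class field theory for the imaginary quadratic field `K` as the only unproved input.

## References

* [Washington1997] L. C. Washington, *Introduction to Cyclotomic Fields*, 2nd ed. (1997), §13.1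
  (p. 264: uniqueness of the `ℤ_p`-extension of `ℚ` from Kronecker–Weber), Thm. 13.4, Thm. 14.1.
* [Greenberg1987] R. Greenberg, *Non-vanishing of certain values of `L`-functions* (1987), §2.
* [Cassels1986] J. W. S. Cassels, *Local Fields* (1986), Ch. 10 §12, Thm. 12.2.
-/

noncomputable section

open Polynomial Field

universe u

namespace Literature.NumberTheory.EllipticCurves

namespace ZpExtension

section KroneckerWeber

variable {K : Type u} [Field K] [CharZero K] {p : ℕ} [Fact p.Prime]

/-- **Step 1 (Kronecker–Weber ⇒ `F mod pⁿ` is cyclotomic).**  Let `K` have the Kronecker–Weber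
property and let `F : Γ_K →ₜ* ℤ_p` be continuous.  For every `n` there is `m ≥ 1` such that
every `σ ∈ Γ_K` fixing the `m`-th roots of unity of `K̄` has `F σ ∈ pⁿ ℤ_p`: the open normal
subgroup `U = F⁻¹(pⁿ ℤ_p)` cuts out (Krull correspondence, `InfiniteGalois.fixingSubgroup_fixedField`)
a finite Galois extension `L = K̄ᵁ` of `K` whose Galois group, a quotient of `Γ_K/U ↪ ℤ/pⁿ`, is
abelian; by Kronecker–Weber `L ⊆ K(μ_m)`, and `σ` fixing `μ_m` fixes `L`, so `σ ∈ U`.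
Ref: Washington, *Introduction to Cyclotomic Fields*, §13.1 (p. 264) and Thm. 14.1. [folklore] -/
theorem exists_forall_smul_eq_self_imp_dvd (hKW : GaloisRepresentations.IsKroneckerWeber K)
    (F : absoluteGaloisGroup K →ₜ* Multiplicative ℤ_[p]) (n : ℕ) :
    ∃ m : ℕ, 0 < m ∧ ∀ σ : absoluteGaloisGroup K,
      (∀ ζ : AlgebraicClosure K, ζ ^ m = 1 → σ • ζ = ζ) → (p : ℤ_[p]) ^ n ∣ (F σ).toAdd := by
  classical
  -- the open normal subgroup `U = F⁻¹(pⁿ ℤ_p)` of `Γ_K`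
  let U : Subgroup (absoluteGaloisGroup K) :=
    (AddSubgroup.toSubgroup (Ideal.span {(p : ℤ_[p]) ^ n}).toAddSubgroup).comap F.toMonoidHom
  have hmemU : ∀ σ, σ ∈ U ↔ (p : ℤ_[p]) ^ n ∣ (F σ).toAdd := fun σ => by
    rw [Subgroup.mem_comap, Multiplicative.mem_toSubgroup, Submodule.mem_toAddSubgroup,
      Ideal.mem_span_singleton]
    rfl
  have hUopen : IsOpen (U : Set (absoluteGaloisGroup K)) := by
    have hball : ((Ideal.span {(p : ℤ_[p]) ^ n} : Ideal ℤ_[p]) : Set ℤ_[p]) =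
        Metric.closedBall (0 : ℤ_[p]) ((p : ℝ) ^ (-n : ℤ)) := by
      ext x
      rw [SetLike.mem_coe, Metric.mem_closedBall, dist_zero_right,
        PadicInt.norm_le_pow_iff_mem_span_pow]
    have hopen : IsOpen ((Ideal.span {(p : ℤ_[p]) ^ n} : Ideal ℤ_[p]) : Set ℤ_[p]) := by
      rw [hball]
      refine IsUltrametricDist.isOpen_closedBall _ (zpow_ne_zero _ ?_)
      exact_mod_cast (Fact.out : p.Prime).ne_zero
    exact hopen.preimage F.continuous
  haveI hUnormal : U.Normal := Subgroup.normal_comap _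
  -- transported to `K̄ ≃ₐ[K] K̄` along the identity
  let U' : Subgroup (AlgebraicClosure K ≃ₐ[K] AlgebraicClosure K) :=
    U.map (absoluteGaloisGroup.toAlgEquiv K).toMonoidHom
  have hU'open : IsOpen (U' : Set (AlgebraicClosure K ≃ₐ[K] AlgebraicClosure K)) := by
    have hHeq : (U' : Set (AlgebraicClosure K ≃ₐ[K] AlgebraicClosure K)) =
        (absoluteGaloisGroup.toAlgEquiv K).symm ⁻¹' U := by
      ext f
      rw [SetLike.mem_coe, Set.mem_preimage, SetLike.mem_coe]
      exact Subgroup.mem_map_equiv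
    have hcont : Continuous (absoluteGaloisGroup.toAlgEquiv K).symm := continuous_id
    rw [hHeq]
    exact hUopen.preimage hcont
  have hU'closed : IsClosed (U' : Set (AlgebraicClosure K ≃ₐ[K] AlgebraicClosure K)) :=
    Subgroup.isClosed_of_isOpen _ hU'open
  have hU'normal : U'.Normal := hUnormal.map _ (absoluteGaloisGroup.toAlgEquiv K).surjective
  -- the fixed field `L = K̄^U`, finite abelian Galois over `K`
  let L : IntermediateField K (AlgebraicClosure K) := IntermediateField.fixedField U'
  have hfix : L.fixingSubgroup = U' :=
    InfiniteGalois.fixingSubgroup_fixedField (⟨U', hU'closed⟩ : ClosedSubgroup _)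
  haveI : FiniteDimensional K L :=
    (InfiniteGalois.isOpen_iff_finite L).mp (by rw [hfix]; exact hU'open)
  haveI : IsGalois K L := (InfiniteGalois.normal_iff_isGalois L).mp (by rw [hfix]; exact hU'normal)
  have hcomm : ∀ f g : L ≃ₐ[K] L, f * g = g * f := by
    intro f g
    obtain ⟨σ', rfl⟩ := AlgEquiv.restrictNormalHom_surjective (AlgebraicClosure K) f
    obtain ⟨τ', rfl⟩ := AlgEquiv.restrictNormalHom_surjective (AlgebraicClosure K) g
    -- the commutator `ρ'` lies in `U'` (the quotient `Γ_K / U ↪ ℤ_p / pⁿ` is abelian) ...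
    set ρ' : AlgebraicClosure K ≃ₐ[K] AlgebraicClosure K := σ' * τ' * σ'⁻¹ * τ'⁻¹ with hρ'
    have hmem : ρ' ∈ U' := by
      refine ⟨(absoluteGaloisGroup.toAlgEquiv K).symm ρ', ?_, ?_⟩
      · rw [SetLike.mem_coe, hmemU]
        have h1 : F ((absoluteGaloisGroup.toAlgEquiv K).symm ρ') = 1 := by
          rw [hρ', map_mul, map_mul, map_mul, map_inv, map_inv, map_mul, map_mul, map_mul, map_inv,
            map_inv, mul_comm (F _) (F ((absoluteGaloisGroup.toAlgEquiv K).symm τ')),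
            mul_inv_cancel_right, mul_inv_cancel]
        rw [h1, toAdd_one]
        exact dvd_zero _
      · exact (absoluteGaloisGroup.toAlgEquiv K).apply_symm_apply _
    -- ... and elements of `U'` restrict trivially to `L = K̄^{U'}`
    have hone : AlgEquiv.restrictNormalHom L ρ' = 1 := by
      ext x
      rw [AlgEquiv.one_apply]
      have hx : ρ' (x : AlgebraicClosure K) = x :=
        (IntermediateField.mem_fixedField_iff U' (x : AlgebraicClosure K)).mp x.2 _ hmem
      have hcommutes := AlgEquiv.restrictNormal_commutes ρ' L x
      change ((ρ'.restrictNormal L x : L) : AlgebraicClosure K) = ρ' (x : AlgebraicClosure K)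
        at hcommutes
      rw [hx] at hcommutes
      exact hcommutes
    rw [hρ', map_mul, map_mul, map_mul, map_inv, map_inv, mul_inv_eq_one, mul_inv_eq_iff_eq_mul]
      at hone
    exact hone
  haveI : IsMulCommutative (L ≃ₐ[K] L) := ⟨⟨hcomm⟩⟩
  haveI : IsAbelianGalois K L := IsAbelianGalois.mk
  -- Kronecker–Weber
  obtain ⟨m, hm0, hLm⟩ := hKW L inferInstance inferInstance
  refine ⟨m, hm0, fun σ hσ => ?_⟩
  rw [← hmemU]
  -- `σ` fixes `K(μ_m) ⊇ L` pointwise, so lies in `Fix(L) = U'`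
  have hσL : absoluteGaloisGroup.toAlgEquiv K σ ∈ L.fixingSubgroup := by
    rw [IntermediateField.mem_fixingSubgroup_iff]
    intro x hx
    exact (IntermediateField.forall_mem_adjoin_smul_eq_self_iff (F := K)
      (S := {ζ : AlgebraicClosure K | ζ ^ m = 1}) σ).mpr (fun ζ hζ => hσ ζ hζ) x (hLm hx)
  rw [hfix] at hσL
  obtain ⟨ρ, hρU, hρσ⟩ := Subgroup.mem_map.mp hσL
  have hρ : ρ = σ := (absoluteGaloisGroup.toAlgEquiv K).injective hρσ
  rw [← hρ]
  exact hρU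

/-- **Step 2 (`Hom(ℤ_ℓˣ, ℤ_p) = 0` for `ℓ ≠ p`, Galois form).**  Assume that for every `n` some
level `m ≥ 1` works for `F` as in `exists_forall_smul_eq_self_imp_dvd`.  If `σ ∈ Γ_K` fixes all
roots of unity of `K̄` of order prime to a prime `ℓ ≠ p`, then `F σ = 0`: writing the level as
`m = ℓᵏ m'` with `ℓ ∤ m'`, `σ^{φ(ℓᵏ)}` fixes `μ_{ℓᵏ}` and `μ_{m'}`, hence `μ_m`, so
`φ(ℓᵏ) F σ ∈ pᴺ ℤ_p`; as `φ(ℓᵏ) = ℓ^{k-1}(ℓ - 1)` with `ℓ` a unit of `ℤ_p`, `(ℓ - 1) F σ ∈ pᴺ ℤ_p`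
for all `N`, so `(ℓ - 1) F σ = 0`.
Ref: Washington, *Introduction to Cyclotomic Fields*, §13.1 (p. 264: no `ℤ_p`-quotient of
`∏_{ℓ ≠ p} ℤ_ℓˣ`). [folklore] -/
theorem toAdd_apply_eq_zero_of_prime_supported {F : absoluteGaloisGroup K →ₜ* Multiplicative ℤ_[p]}
    (hF : ∀ n : ℕ, ∃ m : ℕ, 0 < m ∧ ∀ σ : absoluteGaloisGroup K,
      (∀ ζ : AlgebraicClosure K, ζ ^ m = 1 → σ • ζ = ζ) → (p : ℤ_[p]) ^ n ∣ (F σ).toAdd)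
    {ℓ : ℕ} (hℓ : ℓ.Prime) (hℓp : ℓ ≠ p) {σ : absoluteGaloisGroup K}
    (hσ : ∀ m : ℕ, ℓ.Coprime m → ∀ ζ : AlgebraicClosure K, ζ ^ m = 1 → σ • ζ = ζ) :
    (F σ).toAdd = 0 := by
  have hp : p.Prime := Fact.out
  -- `ℓ` is a unit of `ℤ_p`, `ℓ - 1 ≠ 0`
  have hℓunit : IsUnit (ℓ : ℤ_[p]) := by
    rw [PadicInt.isUnit_iff]
    by_contra hne
    have hlt : ‖((ℓ : ℤ) : ℤ_[p])‖ < 1 :=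
      lt_of_le_of_ne (PadicInt.norm_le_one _) (by exact_mod_cast hne)
    rw [PadicInt.norm_int_lt_one_iff_dvd] at hlt
    have hdvd : p ∣ ℓ := by exact_mod_cast hlt
    exact hℓp ((Nat.prime_dvd_prime_iff_eq hp hℓ).mp hdvd).symm
  have hℓ1 : ((ℓ - 1 : ℕ) : ℤ_[p]) ≠ 0 := by
    exact_mod_cast Nat.sub_ne_zero_of_lt hℓ.one_lt
  suffices h : ((ℓ - 1 : ℕ) : ℤ_[p]) * (F σ).toAdd = 0 from (mul_eq_zero.mp h).resolve_left hℓ1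
  refine PadicUnits.eq_zero_of_forall_pow_dvd fun N => ?_
  obtain ⟨m, hm0, hm⟩ := hF N
  obtain ⟨k, m', hm', rfl⟩ := Nat.exists_eq_pow_mul_and_not_dvd hm0.ne' ℓ hℓ.one_lt.ne'
  haveI : NeZero (ℓ ^ k) := ⟨pow_ne_zero _ hℓ.ne_zero⟩
  have hm'0 : m' ≠ 0 := by
    rintro rfl
    simp at hm0
  haveI : NeZero m' := ⟨hm'0⟩
  have hcopm' : ℓ.Coprime m' := (Nat.Prime.coprime_iff_not_dvd hℓ).mpr hm'
  -- `σ ^ φ(ℓᵏ)` fixes the `m`-th roots of unity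
  have hfixes : ∀ ζ : AlgebraicClosure K, ζ ^ (ℓ ^ k * m') = 1 →
      σ ^ Nat.totient (ℓ ^ k) • ζ = ζ :=
    GaloisRepresentations.RootOfUnityAction.smul_eq_self_of_coprime (hcopm'.pow_left k) _
      (fun ζ hζ => GaloisRepresentations.RootOfUnityAction.pow_totient_smul_eq_self _ ζ hζ)
      (fun ζ hζ => GaloisRepresentations.RootOfUnityAction.pow_smul_eq_self σ (hσ m' hcopm') _ ζ hζ)
  have hdvd := hm _ hfixes
  rw [map_pow, toAdd_pow, nsmul_eq_mul] at hdvd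
  rcases Nat.eq_zero_or_pos k with rfl | hk
  · rw [pow_zero, Nat.totient_one, Nat.cast_one, one_mul] at hdvd
    exact Dvd.dvd.mul_left hdvd _
  · rw [Nat.totient_prime_pow hℓ hk, Nat.cast_mul, Nat.cast_pow, mul_assoc] at hdvd
    exact (IsUnit.dvd_mul_left (hℓunit.pow _)).mp hdvd

/-- **Step 3 (`F` is trivial on the fixer of `μ_{p^∞}`).**  Assume all cyclotomic polynomials
are irreducible over `K` and the levels `m` exist for `F` as in
`exists_forall_smul_eq_self_imp_dvd`.  If `τ ∈ Γ_K` fixes all `p`-power roots of unity of `K̄`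
then `F τ = 0`.  Proof: fix `n` and its level `m`; by induction on the set `T` of primes
`ℓ ∣ m`, `ℓ ≠ p` at which `τ` is not yet known to act trivially, multiply `τ` by `σ_ℓ⁻¹` with
`σ_ℓ` acting like `τ` on `μ_{ℓ^∞}` and trivially at all other primes
(`RootOfUnityAction.exists_smul_eq_smul_and_smul_eq_self`); `F σ_ℓ = 0` by step 2, and at the
end `τ` fixes `μ_m`, so `F τ ∈ pⁿ ℤ_p`.
Ref: Washington, *Introduction to Cyclotomic Fields*, §13.1 (p. 264). [folklore] -/
theorem toAdd_apply_eq_zero_of_forall_smul_eq_self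
    (hirr : ∀ n : ℕ, 0 < n → Irreducible (cyclotomic n K))
    {F : absoluteGaloisGroup K →ₜ* Multiplicative ℤ_[p]}
    (hF : ∀ n : ℕ, ∃ m : ℕ, 0 < m ∧ ∀ σ : absoluteGaloisGroup K,
      (∀ ζ : AlgebraicClosure K, ζ ^ m = 1 → σ • ζ = ζ) → (p : ℤ_[p]) ^ n ∣ (F σ).toAdd)
    {τ : absoluteGaloisGroup K}
    (hτ : ∀ (k : ℕ) (ζ : AlgebraicClosure K), ζ ^ p ^ k = 1 → τ • ζ = ζ) :
    (F τ).toAdd = 0 := by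
  classical
  have hp : p.Prime := Fact.out
  refine PadicUnits.eq_zero_of_forall_pow_dvd fun n => ?_
  obtain ⟨m, hm0, hm⟩ := hF n
  suffices key : ∀ (T : Finset ℕ) (τ' : absoluteGaloisGroup K),
      (∀ (k : ℕ) (ζ : AlgebraicClosure K), ζ ^ p ^ k = 1 → τ' • ζ = ζ) →
      (∀ q ∈ m.primeFactors, q ≠ p → q ∉ T →
        ∀ (k : ℕ) (ζ : AlgebraicClosure K), ζ ^ q ^ k = 1 → τ' • ζ = ζ) →
      (p : ℤ_[p]) ^ n ∣ (F τ').toAdd by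
    exact key (m.primeFactors.erase p) τ hτ
      fun q hq hqp hqT => absurd (Finset.mem_erase.mpr ⟨hqp, hq⟩) hqT
  intro T
  induction T using Finset.induction_on with
  | empty =>
    intro τ' h1 h2
    refine hm τ' (GaloisRepresentations.RootOfUnityAction.smul_eq_self_of_forall_prime hm0.ne' τ' fun q hq hqm => ?_)
    by_cases hqp : q = p
    · subst hqp
      exact h1
    · exact h2 q (Nat.mem_primeFactors.mpr ⟨hq, hqm, hm0.ne'⟩) hqp (Finset.notMem_empty q)
  | @insert ℓ T hℓT ih =>
    intro τ' h1 h2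
    by_cases hℓ : ℓ ∈ m.primeFactors ∧ ℓ ≠ p
    · obtain ⟨hℓm, hℓp⟩ := hℓ
      have hℓprime : ℓ.Prime := Nat.prime_of_mem_primeFactors hℓm
      obtain ⟨σ, hσ1, hσ2⟩ :=
        GaloisRepresentations.RootOfUnityAction.exists_smul_eq_smul_and_smul_eq_self hirr hℓprime τ'
      have hσF : (F σ).toAdd = 0 := toAdd_apply_eq_zero_of_prime_supported hF hℓprime hℓp hσ2
      have hih : (p : ℤ_[p]) ^ n ∣ (F (σ⁻¹ * τ')).toAdd := by
        refine ih (σ⁻¹ * τ') (fun k ζ hζ => ?_) (fun q hq hqp hqT k ζ hζ => ?_)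
        · rw [mul_smul, inv_smul_eq_iff, h1 k ζ hζ]
          exact (hσ2 (p ^ k) (((Nat.coprime_primes hℓprime hp).mpr hℓp).pow_right k) ζ hζ).symm
        · rw [mul_smul, inv_smul_eq_iff]
          by_cases hqℓ : q = ℓ
          · subst hqℓ
            exact (hσ1 k ζ hζ).symm
          · have hq' : q ∉ insert ℓ T := by
              rw [Finset.mem_insert, not_or]
              exact ⟨hqℓ, hqT⟩
            rw [h2 q hq hqp hq' k ζ hζ]
            exact (hσ2 (q ^ k) (((Nat.coprime_primes hℓprime
              (Nat.prime_of_mem_primeFactors hq)).mpr (Ne.symm hqℓ)).pow_right k) ζ hζ).symm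
      have hsplit : F τ' = F σ * F (σ⁻¹ * τ') := by rw [← map_mul, mul_inv_cancel_left]
      rw [hsplit, toAdd_mul, hσF, zero_add]
      exact hih
    · refine ih τ' h1 fun q hq hqp hqT => h2 q hq hqp ?_
      rw [Finset.mem_insert, not_or]
      exact ⟨fun h => hℓ ⟨h ▸ hq, h ▸ hqp⟩, hqT⟩

/-- **Step 4a.**  With the Kronecker–Weber property and irreducible cyclotomic polynomials, every
continuous character `F : Γ_K →ₜ* ℤ_p` is trivial on `ker χ_p` (steps 1–3 and
`GaloisRep.smul_eq_self_of_cyclotomicCharacter_eq_one`), i.e. every `ℤ_p`-extension of `K` lies in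
`K(μ_{p^∞})`.  Ref: Washington, *Introduction to Cyclotomic Fields*, §13.1 (p. 264). [folklore] -/
theorem apply_eq_one_of_cyclotomicCharacter_eq_one
    (hirr : ∀ n : ℕ, 0 < n → Irreducible (cyclotomic n K)) (hKW : GaloisRepresentations.IsKroneckerWeber K)
    (F : absoluteGaloisGroup K →ₜ* Multiplicative ℤ_[p]) {σ : absoluteGaloisGroup K}
    (hσ : GaloisRepresentations.GaloisRep.cyclotomicCharacter K p σ = 1) : F σ = 1 := by
  have h := toAdd_apply_eq_zero_of_forall_smul_eq_self hirr
    (fun n => exists_forall_smul_eq_self_imp_dvd hKW F n)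
    (GaloisRepresentations.GaloisRep.smul_eq_self_of_cyclotomicCharacter_eq_one K p hσ)
  exact Multiplicative.toAdd.injective h

/-- **`ℤ_p`-rank at most one from Kronecker–Weber.**  Let `K` be a field of characteristic `0`
with the Kronecker–Weber property over which all cyclotomic polynomials are irreducible (i.e.
`K = ℚ`).  Then any two continuous characters `F₁, F₂ : Γ_K →ₜ* ℤ_p` are `ℤ_p`-linearly
dependent: both factor through `χ_p : Γ_K → ℤ_pˣ` (step 4a,
`GaloisRep.exists_continuousMonoidHom_comp_cyclotomicCharacter`) and any two continuous
characters of `ℤ_pˣ` are dependent (`PadicUnits.dependent`).  This is the uniqueness of the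
`ℤ_p`-extension of `ℚ`.  Ref: Washington, *Introduction to Cyclotomic Fields*, §13.1 (p. 264)
and Thm. 13.4 (`r₂(ℚ) + 1 = 1`). [folklore] -/
theorem dependent_of_isKroneckerWeber
    (hirr : ∀ n : ℕ, 0 < n → Irreducible (cyclotomic n K)) (hKW : GaloisRepresentations.IsKroneckerWeber K)
    (F₁ F₂ : absoluteGaloisGroup K →ₜ* Multiplicative ℤ_[p]) :
    ∃ a b : ℤ_[p], (a ≠ 0 ∨ b ≠ 0) ∧ ∀ ρ, a * (F₁ ρ).toAdd = b * (F₂ ρ).toAdd := by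
  obtain ⟨g₁, hg₁⟩ := GaloisRepresentations.GaloisRep.exists_continuousMonoidHom_comp_cyclotomicCharacter K p hirr F₁
    fun σ hσ => apply_eq_one_of_cyclotomicCharacter_eq_one hirr hKW F₁ hσ
  obtain ⟨g₂, hg₂⟩ := GaloisRepresentations.GaloisRep.exists_continuousMonoidHom_comp_cyclotomicCharacter K p hirr F₂
    fun σ hσ => apply_eq_one_of_cyclotomicCharacter_eq_one hirr hKW F₂ hσ
  obtain ⟨a, b, hab, h⟩ := PadicUnits.dependent g₁ g₂
  refine ⟨a, b, hab, fun ρ => ?_⟩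
  rw [← hg₁ ρ, ← hg₂ ρ]
  exact h _

end KroneckerWeber

section Rat

variable {p : ℕ} [Fact p.Prime]

/-- **`Hom_cont(Γ_ℚ, ℤ_p)` has `ℤ_p`-rank `≤ 1`, from the Kronecker–Weber theorem**: any two
continuous characters `Γ_ℚ →ₜ* ℤ_p` are `ℤ_p`-linearly dependent (`dependent_of_isKroneckerWeber`
at `K = ℚ`, the cyclotomic polynomials being irreducible over `ℚ`,
`Polynomial.cyclotomic.irreducible_rat`).  Equivalently `ℚ_∞`, the cyclotomic one, is the only
`ℤ_p`-extension of `ℚ`.  Ref: Washington, *Introduction to Cyclotomic Fields*, §13.1 (p. 264).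
[folklore] -/
theorem dependent_of_kroneckerWeber (hKW : GaloisRepresentations.KroneckerWeber)
    (F₁ F₂ : absoluteGaloisGroup ℚ →ₜ* Multiplicative ℤ_[p]) :
    ∃ a b : ℤ_[p], (a ≠ 0 ∨ b ≠ 0) ∧ ∀ ρ, a * (F₁ ρ).toAdd = b * (F₂ ρ).toAdd :=
  dependent_of_isKroneckerWeber (fun _ hn => cyclotomic.irreducible_rat hn) hKW F₁ F₂

variable {K : Type u} [Field K] [NumberField K]

open NumberField NumberField.InfinitePlace in
/-- **The anticyclotomic `ℤ_p`-extension exists, given Kronecker–Weber and the `ℤ_p`-rank of `K`.**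
For `K` imaginary quadratic, `exists_isAnticyclotomic` follows from the Kronecker–Weber theorem
(named fact `KroneckerWeber`, supplying the rank-`≤ 1` hypothesis `hG` for `Γ_ℚ`,
`dependent_of_kroneckerWeber`) and the class-field-theoretic `ℤ_p`-rank fact for `K`
(`zpRank_eq_nrComplexPlaces_add_one K p`: `Gal(K̃/K) ≃ ℤ_p²`, supplying two jointly surjective
characters, `exists_pair_of_zpRank`), via the index-two descent
`IndexTwo.exists_surjective_anticyclotomic` with the Galois glue of `ZpExtensionProofs.lean`
(`inv_mul_mem_range_absGaloisRestrict`, `exists_not_mem_range_absGaloisRestrict`).  Compared with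
`exists_isAnticyclotomic_of_zpRank_facts` the rank fact for `ℚ` is no longer assumed.
Ref: Greenberg (1987), §2; Washington, §13.1 and Thm. 13.4, Thm. 14.1. [cite: Greenberg1987, §2] -/
theorem exists_isAnticyclotomic_of_kroneckerWeber (hKW : GaloisRepresentations.KroneckerWeber)
    (hKr : zpRank_eq_nrComplexPlaces_add_one K p) :
    exists_isAnticyclotomic (K := K) (p := p) := by
  intro _ hK himag
  obtain ⟨c, hc, hc2⟩ := exists_not_mem_range_absGaloisRestrict K (Rat.castHom ℝ) himag
  have hH := exists_pair_of_zpRank hK himag (hKr (units_rank_eq_zero_of_finrank_eq_two hK himag))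
  obtain ⟨κ, hsurj, hanti⟩ := IndexTwo.exists_surjective_anticyclotomic
    (GaloisRepresentations.absGaloisRestrict_injective ℚ K) hc hc2
    (fun ρ ρ' hρ hρ' => inv_mul_mem_range_absGaloisRestrict hK hρ hρ')
    (dependent_of_kroneckerWeber hKW) hH
  exact ⟨⟨κ, hsurj⟩, fun σ τ ρ hρ h => hanti σ τ ρ hρ h⟩

end Rat

end ZpExtension

end Literature.NumberTheory.EllipticCurves
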